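import Literature.Probability.LatticeModels.MeshLoops
import Literature.Probability.RandomPlanarGeometry.ExteriorULC
import HarnessLib

/-!
# Windows of a mesh column are crossed an even number of times (Jordan domains)

Topic: Probability / LatticeModels (fourth file of the "bulk = largest mesh component for every
Jordan domain" theorem, `MeshDomainJordan.lean`; sub-namespace `…LatticeModels.Mesh`). Let `D` be
a Jordan domain, `Ω = D.carrier`, `δ > 0`, and fix a column `k` and a *window* `jb < jt` of it:
the cells `(k, jb)` and `(k, jt)` are **not perfect** and the window is short,
`δ (jt - jb) + 8δ < η`, where `η` is a modulus of uniform local connectedness of the exterior for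
the radius `D₀/16` (`JordanDomain.exterior_joinedIn_of_dist_lt`). Let `W` be a walk in the mesh
graph on mesh vertices whose two ends are at distance `≥ D₀/8` from the centre of cell
`(k, jb)` (with `η ≤ D₀/16`).

**Theorem** (`even_windowRungCount`): `W` traverses the rungs `j'` of column `k` with
`jb < j' ≤ jt` an even number of times (with multiplicity).

Proof (the short loop). Access paths (`exists_accessPath`) lead from the centres of the two
non-perfect cells to exterior points `x⁻`, `x⁺` within `4δ`; these are `< η` apart, so a path
`Z` in the exterior of diameter `< D₀/8` joins them. The loop
`σ = (access⁻)⁻¹ · spine · access⁺ · Z` meets the trace of `W` only where the vertical spine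
`re z = δ(k + ½)` crosses the window rungs, each at its midpoint, transversally: the other points
of `σ` avoid the mesh (`AvoidsMesh`). Hence the winding number of `σ` about the mesh point of a
vertex of `W` is constant along every step of `W` that is not a window rung and changes by `±1`
along a window rung (`crossInc`: the spine contributes `2πi`, the rest nothing), while it vanishes
at both ends of `W` (they are outside the ball of radius `D₀/8` containing `σ`). Parity finishes.

Folklore (the device is the standard "short dual obstacle" argument; no source states this lemma).
Mathlib anchors: `Path`, `JoinedIn.somePath`, `SimpleGraph.Walk.darts`, `List.countP`. H21
anchors: `wind`, `Path.crossInc`, `crossInc_loop`, `crossInc_trans`, `crossInc_symm`,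
`crossInc_eq_zero`, `wind_sub_eq_of_mem_connectedComponentIn` (`ArgumentIncrement.lean`),
`JordanDomain.exterior_joinedIn_of_dist_lt` (`ExteriorULC.lean`), `Mesh.exists_accessPath`,
`Mesh.crossInc_spine_rung`, `Mesh.wind_sub_eq_zero_of_subset_ball` (`MeshLoops.lean`).
-/

namespace Literature.Probability.LatticeModels.Mesh

open Set Complex Metric Literature.Topology.PlaneTopology
open Literature.Probability.RandomPlanarGeometry

noncomputable section

/-! ### A parity lemma along lattice walks -/

open Classical in
/-- **Parity bookkeeping along a walk.** Let `T` be a set of lattice edges and `w` an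
integer-valued function on sites such that along every dart of the walk `W` the value of `w`
changes by an odd amount if the edge is in `T` and not at all otherwise. Then the number of
`T`-edges traversed by `W` is even iff `w` has values of the same parity at the two ends.
[folklore] -/
theorem even_countP_iff_of_darts {u v : Site 2} (W : (zdGraph 2).Walk u v) (T : Sym2 (Site 2) → Prop)
    (w : Site 2 → ℤ)
    (hT : ∀ d ∈ W.darts, T d.edge → Odd (w d.fst - w d.snd))
    (hnT : ∀ d ∈ W.darts, ¬ T d.edge → w d.fst = w d.snd) :
    Even (W.edges.countP fun e => decide (T e)) ↔ Even (w u - w v) := by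
  induction W with
  | nil => simp
  | @cons a b c h W ih =>
    have hT' : ∀ d ∈ W.darts, T d.edge → Odd (w d.fst - w d.snd) := fun d hd =>
      hT d (by rw [SimpleGraph.Walk.darts_cons]; exact List.mem_cons_of_mem _ hd)
    have hnT' : ∀ d ∈ W.darts, ¬ T d.edge → w d.fst = w d.snd := fun d hd =>
      hnT d (by rw [SimpleGraph.Walk.darts_cons]; exact List.mem_cons_of_mem _ hd)
    have ih' := ih hT' hnT'
    have hd0 : (⟨(a, b), h⟩ : (zdGraph 2).Dart) ∈ (SimpleGraph.Walk.cons h W).darts := by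
      rw [SimpleGraph.Walk.darts_cons]; exact List.mem_cons_self
    rw [SimpleGraph.Walk.edges_cons]
    have hsplit : w a - w c = (w a - w b) + (w b - w c) := by ring
    by_cases hab : T s(a, b)
    · have hodd : Odd (w a - w b) := hT _ hd0 hab
      have hc : List.countP (fun e => decide (T e)) (s(a, b) :: W.edges) =
          List.countP (fun e => decide (T e)) W.edges + 1 := by
        simp [hab]
      rw [hc, Nat.even_add_one, ih', hsplit, Int.even_add]
      constructor
      · intro h1
        exact ⟨fun h2 => absurd h2 (Int.not_even_iff_odd.2 hodd), fun h2 => absurd h2 h1⟩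
      · intro h1 h2
        exact Int.not_even_iff_odd.2 hodd (h1.2 h2)
    · have heq : w a = w b := hnT _ hd0 hab
      have hc : List.countP (fun e => decide (T e)) (s(a, b) :: W.edges) =
          List.countP (fun e => decide (T e)) W.edges := by
        simp [hab]
      rw [hc, ih', hsplit, heq, sub_self, zero_add]

/-! ### Spine points on mesh edges are window rungs -/

/-- `δ(k + ½)` is not an integer multiple of `δ` (`δ > 0`). [folklore] -/
theorem half_ne_mul_int {δ : ℝ} (hδ : 0 < δ) (k m : ℤ) : δ * (k + 1 / 2) ≠ δ * m :=
  ne_mul_int_of_mem_Ioo hδ (n := k) ⟨by nlinarith, by nlinarith⟩ m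

/-- **A spine point on a closed mesh edge lies on a window rung.** If a point with
`re z = δ(k + ½)` and `δ(jb + ½) ≤ im z ≤ δ(jt + ½)` lies on the closed lattice edge `[δa, δb]`
(`a ∼ b` in `ℤ²`), then that edge is the rung `j'` of column `k` for some `jb < j' ≤ jt`.
[folklore] -/
theorem exists_eq_rung_of_mem_segment {δ : ℝ} (hδ : 0 < δ) {k jb jt : ℤ} {a b : Site 2}
    (hab : (zdGraph 2).Adj a b) {z : ℂ} (hz : z ∈ segment ℝ (meshPoint δ a) (meshPoint δ b))
    (hre : z.re = δ * (k + 1 / 2)) (him1 : δ * (jb + 1 / 2) ≤ z.im) (him2 : z.im ≤ δ * (jt + 1 / 2)) :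
    ∃ j', jb < j' ∧ j' ≤ jt ∧ s(a, b) = rung k j' := by
  obtain ⟨i, hi, hl⟩ := exists_coord_eq_of_adj hab
  obtain ⟨α, β, hα, hβ, hαβ, rfl⟩ := hz
  simp only [add_re, smul_re, meshPoint_re, smul_eq_mul, add_im, smul_im, meshPoint_im] at hre him1 him2
  fin_cases i
  · -- horizontal edge at height `δ (a 1)`
    have h1 : b 1 = a 1 := hl 1 (by decide)
    rw [h1, ← add_mul, hαβ, one_mul] at him1 him2
    have hj1 : jb < a 1 := by
      have : (jb : ℝ) + 1 / 2 ≤ a 1 := le_of_mul_le_mul_left him1 hδ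
      have : (jb : ℝ) < a 1 := by linarith
      exact_mod_cast this
    have hj2 : a 1 ≤ jt := by
      have : (a 1 : ℝ) ≤ jt + 1 / 2 := le_of_mul_le_mul_left him2 hδ
      have h' : (a 1 : ℝ) < jt + 1 := by linarith
      have : a 1 < jt + 1 := by exact_mod_cast h'
      omega
    refine ⟨a 1, hj1, hj2, ?_⟩
    -- the first coordinates: `{a 0, b 0} = {k, k + 1}`
    have key : α * (a 0 : ℝ) + β * (b 0 : ℝ) = k + 1 / 2 := by
      have : δ * (α * (a 0 : ℝ) + β * (b 0 : ℝ)) = δ * (k + 1 / 2) := by rw [← hre]; ring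
      exact mul_left_cancel₀ hδ.ne' this
    rcases hi with hb0 | ha0
    · have hb0' : (b 0 : ℝ) = a 0 + 1 := by exact_mod_cast hb0
      rw [hb0'] at key
      have hk : (k : ℝ) + 1 / 2 = a 0 + β := by linear_combination -key + (a 0 : ℝ) * hαβ
      have hlo : a 0 ≤ k := by
        have : (a 0 : ℝ) ≤ k + 1 / 2 := by rw [hk]; linarith
        have : (a 0 : ℝ) < k + 1 := by linarith
        have : a 0 < k + 1 := by exact_mod_cast this
        omega
      have hhi : k ≤ a 0 := by
        have : (k : ℝ) + 1 / 2 ≤ a 0 + 1 := by rw [hk]; linarith [hβ, hα]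
        have : (k : ℝ) < a 0 + 1 := by linarith
        have : k < a 0 + 1 := by exact_mod_cast this
        omega
      have ha0k : a 0 = k := le_antisymm hlo hhi
      have hb0k : b 0 = k + 1 := by have : b 0 = a 0 + 1 := hb0; omega
      have hA : a = corner k (a 1) false false := by
        funext l; fin_cases l
        · simpa [corner] using ha0k
        · simp [corner]
      have hB : b = corner k (a 1) true false := by
        funext l; fin_cases l
        · simpa [corner] using hb0k
        · simpa [corner] using h1
      rw [rung, ← hA, ← hB]
    · have ha0' : (a 0 : ℝ) = b 0 + 1 := by exact_mod_cast ha0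
      rw [ha0'] at key
      have hk : (k : ℝ) + 1 / 2 = b 0 + α := by linear_combination -key + (b 0 : ℝ) * hαβ
      have hlo : b 0 ≤ k := by
        have : (b 0 : ℝ) ≤ k + 1 / 2 := by rw [hk]; linarith
        have : (b 0 : ℝ) < k + 1 := by linarith
        have : b 0 < k + 1 := by exact_mod_cast this
        omega
      have hhi : k ≤ b 0 := by
        have : (k : ℝ) + 1 / 2 ≤ b 0 + 1 := by rw [hk]; linarith [hβ, hα]
        have : (k : ℝ) < b 0 + 1 := by linarith
        have : k < b 0 + 1 := by exact_mod_cast this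
        omega
      have hb0k : b 0 = k := le_antisymm hlo hhi
      have ha0k : a 0 = k + 1 := by have : a 0 = b 0 + 1 := ha0; omega
      have hA : a = corner k (a 1) true false := by
        funext l; fin_cases l
        · simpa [corner] using ha0k
        · simp [corner]
      have hB : b = corner k (a 1) false false := by
        funext l; fin_cases l
        · simpa [corner] using hb0k
        · simpa [corner] using h1
      rw [rung, ← hA, ← hB, Sym2.eq_swap]
  · -- vertical edge: `re z = δ (a 0)`, impossible
    exfalso
    have h0 : b 0 = a 0 := hl 0 (by decide)
    rw [h0, ← add_mul, hαβ, one_mul] at hre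
    exact half_ne_mul_int hδ k (a 0) hre.symm

/-! ### The main parity theorem -/

variable (D : JordanDomain)

open Classical in
/-- **Windows are crossed evenly.** See the module docstring. `hη` is the uniform local
connectedness of the exterior at radius `D₀/16` (from `exterior_joinedIn_of_dist_lt`), the cells
`(k, jb)`, `(k, jt)` are not perfect, the window is short, and the two ends of the walk `W` (a
walk of `ℤ²` through mesh vertices along mesh edges) are at distance `≥ D₀/8` from the centre of
cell `(k, jb)`. Then the number of edges of `W` among the rungs `jb < j' ≤ jt` of column `k` is
even. [folklore] -/
theorem even_windowRungCount {δ D₀ η : ℝ} (hδ : 0 < δ) (hηD : η ≤ D₀ / 16)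
    (hulc : ∀ x ∈ (closure D.carrier)ᶜ, ∀ y ∈ (closure D.carrier)ᶜ, dist x y < η →
      JoinedIn ((closure D.carrier)ᶜ ∩ ball x (D₀ / 16)) x y)
    {k jb jt : ℤ} (hjt : jb < jt) (hbot : ¬ IsPerfect D.carrier δ k jb)
    (htop : ¬ IsPerfect D.carrier δ k jt) (hshort : δ * (jt - jb) + 8 * δ < η)
    {u v : Site 2} (W : (zdGraph 2).Walk u v) (hWs : ∀ a ∈ W.support, a ∈ meshVertices D.carrier δ)
    (hWd : ∀ d ∈ W.darts, (meshGraph D.carrier δ).Adj d.fst d.snd)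
    (hu : D₀ / 8 ≤ dist (meshPoint δ u) (cellCenter δ k jb))
    (hv : D₀ / 8 ≤ dist (meshPoint δ v) (cellCenter δ k jb)) :
    Even (W.edges.countP fun e => decide (∃ j', jb < j' ∧ j' ≤ jt ∧ e = rung k j')) := by
  set Ω := D.carrier with hΩ
  have hΩo : IsOpen Ω := D.isOpen
  have hJE : frontier Ω ⊆ closure (closure Ω)ᶜ := D.frontier_subset_closure_exterior'
  -- access paths and the exterior arc
  obtain ⟨xm, hxmE, Am, hAm, hAmd⟩ := exists_accessPath hΩo hJE hδ hbot
  obtain ⟨xp, hxpE, Ap, hAp, hApd⟩ := exists_accessPath hΩo hJE hδ htop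
  have hle : jb ≤ jt := hjt.le
  have hcc : dist (cellCenter δ k jt) (cellCenter δ k jb) = δ * (jt - jb) := by
    rw [Complex.dist_eq]
    have : cellCenter δ k jt - cellCenter δ k jb = ((δ * (jt - jb) : ℝ) : ℂ) * I := by
      apply Complex.ext
      · simp
      · simp; ring
    rw [this, norm_mul, Complex.norm_I, mul_one, Complex.norm_real, Real.norm_eq_abs,
      abs_of_nonneg (by nlinarith [(by exact_mod_cast hle : (jb : ℝ) ≤ jt)])]
  have hxdist : dist xp xm < η := by
    calc dist xp xm ≤ dist xp (cellCenter δ k jt) + dist (cellCenter δ k jt) (cellCenter δ k jb) + dist (cellCenter δ k jb) xm := dist_triangle4 _ _ _ _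
      _ < 4 * δ + δ * (jt - jb) + 4 * δ := by
          have h1 := hApd 1; have h2 := hAmd 1
          simp only [Path.target] at h1 h2
          rw [dist_comm] at h2
          linarith
      _ < η := by linarith
  set Z : Path xp xm := (hulc xp hxpE xm hxmE hxdist).somePath with hZdef
  have hZ : ∀ t, Z t ∈ (closure Ω)ᶜ ∩ ball xp (D₀ / 16) := (hulc xp hxpE xm hxmE hxdist).somePath_mem
  -- the loop
  set V : Path (cellCenter δ k jb) (cellCenter δ k jt) := Path.segment (cellCenter δ k jb) (cellCenter δ k jt) with hV
  set σ : Path xm xm := ((Am.symm.trans V).trans Ap).trans Z with hσ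
  -- its range: every point avoids the mesh or lies on the spine
  have hrange : ∀ z ∈ range σ, AvoidsMesh Ω δ z ∨ z ∈ segment ℝ (cellCenter δ k jb) (cellCenter δ k jt) := by
    intro z hz
    rw [hσ, Path.trans_range, Path.trans_range, Path.trans_range, Path.symm_range, hV,
      Path.range_segment] at hz
    rcases hz with ((⟨t, rfl⟩ | hz) | ⟨t, rfl⟩) | ⟨t, rfl⟩
    · exact Or.inl (hAm t)
    · exact Or.inr hz
    · exact Or.inl (hAp t)
    · exact Or.inl (avoidsMesh_of_mem_exterior (hZ t).1)
  -- its range lies in the ball of radius `D₀/8` about `cb`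
  have hball : range σ ⊆ ball (cellCenter δ k jb) (D₀ / 8) := by
    intro z hz
    rw [hσ, Path.trans_range, Path.trans_range, Path.trans_range, Path.symm_range, hV,
      Path.range_segment] at hz
    rw [mem_ball]
    have hδη : 4 * δ < η := by nlinarith [(by exact_mod_cast hle : (jb : ℝ) ≤ jt)]
    rcases hz with ((⟨t, rfl⟩ | hz) | ⟨t, rfl⟩) | ⟨t, rfl⟩
    · linarith [hAmd t]
    · have := dist_le_of_mem_spine (k := k) hle hδ.le hz
      linarith
    · calc dist (Ap t) (cellCenter δ k jb) ≤ dist (Ap t) (cellCenter δ k jt) + dist (cellCenter δ k jt) (cellCenter δ k jb) := dist_triangle _ _ _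
        _ < 4 * δ + δ * (jt - jb) := by linarith [hApd t]
        _ < D₀ / 8 := by linarith
    · calc dist (Z t) (cellCenter δ k jb) ≤ dist (Z t) xp + dist xp (cellCenter δ k jt) + dist (cellCenter δ k jt) (cellCenter δ k jb) := dist_triangle4 _ _ _ _
        _ < D₀ / 16 + 4 * δ + δ * (jt - jb) := by
            have h1 := mem_ball.1 (hZ t).2
            have h2 := hApd 1
            simp only [Path.target] at h2
            linarith
        _ ≤ D₀ / 8 := by linarith
  -- mesh vertices are off the loop
  have hoff : ∀ a ∈ meshVertices Ω δ, meshPoint δ a ∉ range σ := by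
    intro a ha hmem
    rcases hrange _ hmem with h | h
    · exact h.1 a ha rfl
    · have := (re_eq_and_im_mem_of_mem_spine hle hδ.le h).1
      rw [meshPoint_re] at this
      exact half_ne_mul_int hδ k (a 0) this.symm
  -- winding numbers about mesh points
  set w : Site 2 → ℤ := fun a => wind fun t => σ.extend t - meshPoint δ a with hw
  have hKc : IsClosed (range σ) := (isCompact_range σ.continuous).isClosed
  -- (1) along a dart that is not a window rung, `w` is constant
  have hconst : ∀ d ∈ W.darts, ¬ (∃ j', jb < j' ∧ j' ≤ jt ∧ d.edge = rung k j') →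
      w d.fst = w d.snd := by
    intro d hd hnot
    have ha : d.fst ∈ meshVertices Ω δ := hWs _ (W.dart_fst_mem_support_of_mem_darts hd)
    have hb : d.snd ∈ meshVertices Ω δ := hWs _ (W.dart_snd_mem_support_of_mem_darts hd)
    have hadj := hWd d hd
    -- the closed edge misses the loop
    have hmiss : segment ℝ (meshPoint δ d.fst) (meshPoint δ d.snd) ⊆ (range σ)ᶜ := by
      intro z hz hzσ
      rcases hrange z hzσ with h | h
      · exact h.2 _ ha _ hb hadj hz
      · obtain ⟨hre, h1, h2⟩ := re_eq_and_im_mem_of_mem_spine hle hδ.le h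
        obtain ⟨j', hj1, hj2, hj⟩ :=
          exists_eq_rung_of_mem_segment hδ (meshGraph_adj_iff.1 hadj).1 hz hre h1 h2
        exact hnot ⟨j', hj1, hj2, by rw [← hj]; rfl⟩
    have hcomp : meshPoint δ d.snd ∈ connectedComponentIn (range σ)ᶜ (meshPoint δ d.fst) :=
      (convex_segment _ _).isPreconnected.subset_connectedComponentIn (left_mem_segment ℝ _ _)
        hmiss (right_mem_segment ℝ _ _)
    exact wind_sub_eq_of_mem_connectedComponentIn σ.continuous_extend.continuousOn (by simp) hKc
      (fun t ht => by rw [Path.extend_apply σ ht]; exact mem_range_self _) hcomp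
  -- (2) across a window rung, `w` jumps by one
  have hjump : ∀ j', jb < j' → j' ≤ jt →
      corner k j' false false ∈ meshVertices Ω δ → corner k j' true false ∈ meshVertices Ω δ →
      (meshGraph Ω δ).Adj (corner k j' false false) (corner k j' true false) →
      w (corner k j' false false) - w (corner k j' true false) = 1 := by
    intro j' hj1 hj2 hl hr hadj
    set ℓ := meshPoint δ (corner k j' false false) with hℓ
    set r := meshPoint δ (corner k j' true false) with hr'
    have hℓσ : ℓ ∉ range σ := hoff _ hl
    have hrσ : r ∉ range σ := hoff _ hr
    -- membership of `ℓ`, `r` in the ranges of the pieces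
    have hrs : range σ = ((range Am ∪ segment ℝ (cellCenter δ k jb) (cellCenter δ k jt)) ∪ range Ap) ∪ range Z := by
      rw [hσ, Path.trans_range, Path.trans_range, Path.trans_range, Path.symm_range, hV,
        Path.range_segment]
    have nAm : ℓ ∉ range Am.symm ∧ r ∉ range Am.symm := by
      rw [Path.symm_range]
      exact ⟨fun h => hℓσ (by rw [hrs]; exact Or.inl (Or.inl (Or.inl h))),
        fun h => hrσ (by rw [hrs]; exact Or.inl (Or.inl (Or.inl h)))⟩
    have nV : ℓ ∉ range V ∧ r ∉ range V := by
      rw [hV, Path.range_segment]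
      exact ⟨fun h => hℓσ (by rw [hrs]; exact Or.inl (Or.inl (Or.inr h))),
        fun h => hrσ (by rw [hrs]; exact Or.inl (Or.inl (Or.inr h)))⟩
    have nAp : ℓ ∉ range Ap ∧ r ∉ range Ap :=
      ⟨fun h => hℓσ (by rw [hrs]; exact Or.inl (Or.inr h)),
        fun h => hrσ (by rw [hrs]; exact Or.inl (Or.inr h))⟩
    have nZ : ℓ ∉ range Z ∧ r ∉ range Z :=
      ⟨fun h => hℓσ (by rw [hrs]; exact Or.inr h), fun h => hrσ (by rw [hrs]; exact Or.inr h)⟩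
    have nAmV : ℓ ∉ range (Am.symm.trans V) ∧ r ∉ range (Am.symm.trans V) := by
      rw [Path.trans_range]
      exact ⟨fun h => h.elim nAm.1 nV.1, fun h => h.elim nAm.2 nV.2⟩
    have nAmVAp : ℓ ∉ range ((Am.symm.trans V).trans Ap) ∧ r ∉ range ((Am.symm.trans V).trans Ap) := by
      rw [Path.trans_range]
      exact ⟨fun h => h.elim nAmV.1 nAp.1, fun h => h.elim nAmV.2 nAp.2⟩
    -- the pieces other than the spine avoid the closed rung
    have hseg_avoid : ∀ z, AvoidsMesh Ω δ z → z ∉ segment ℝ ℓ r := fun z hz =>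
      hz.2 _ hl _ hr hadj
    have cAm : Am.symm.crossInc ℓ r = 0 :=
      Path.crossInc_eq_zero _ fun t => hseg_avoid _ (hAm (unitInterval.symm t))
    have cAp : Ap.crossInc ℓ r = 0 := Path.crossInc_eq_zero _ fun t => hseg_avoid _ (hAp t)
    have cZ : Z.crossInc ℓ r = 0 :=
      Path.crossInc_eq_zero _ fun t => hseg_avoid _ (avoidsMesh_of_mem_exterior (hZ t).1)
    have cV : V.crossInc ℓ r = 2 * Real.pi * I := crossInc_spine_rung hδ k hj1 hj2
    have ctot : σ.crossInc ℓ r = 2 * Real.pi * I := by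
      rw [hσ, Path.crossInc_trans _ _ nAmVAp.1 nZ.1 nAmVAp.2 nZ.2,
        Path.crossInc_trans _ _ nAmV.1 nAp.1 nAmV.2 nAp.2,
        Path.crossInc_trans _ _ nAm.1 nV.1 nAm.2 nV.2, cAm, cV, cAp, cZ]
      ring
    have hloop := Path.crossInc_loop σ hℓσ hrσ
    rw [ctot] at hloop
    have h2pi : (2 * Real.pi * I : ℂ) ≠ 0 := by
      simp [Real.pi_ne_zero, Complex.I_ne_zero]
    have : ((w (corner k j' false false) - w (corner k j' true false) : ℤ) : ℂ) = 1 := by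
      have h1 : (1 : ℂ) * (2 * Real.pi * I) =
          ((wind fun t => σ.extend t - ℓ) - wind fun t => σ.extend t - r) * (2 * Real.pi * I) := by
        rw [one_mul]; exact hloop
      have := mul_right_cancel₀ h2pi h1
      rw [hw]
      push_cast
      exact this.symm
    exact_mod_cast this
  -- (3) the parity lemma
  have hT : ∀ d ∈ W.darts, (∃ j', jb < j' ∧ j' ≤ jt ∧ d.edge = rung k j') →
      Odd (w d.fst - w d.snd) := by
    rintro d hd ⟨j', hj1, hj2, hj⟩
    have ha : d.fst ∈ meshVertices Ω δ := hWs _ (W.dart_fst_mem_support_of_mem_darts hd)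
    have hb : d.snd ∈ meshVertices Ω δ := hWs _ (W.dart_snd_mem_support_of_mem_darts hd)
    have hadj := hWd d hd
    have hj' : s(d.fst, d.snd) = rung k j' := hj
    rw [rung, Sym2.eq_iff] at hj'
    rcases hj' with ⟨h1, h2⟩ | ⟨h1, h2⟩
    · rw [h1, h2] at hadj ⊢
      rw [h1] at ha; rw [h2] at hb
      rw [hjump j' hj1 hj2 ha hb hadj]
      exact odd_one
    · rw [h1, h2] at hadj ⊢
      rw [h1] at ha; rw [h2] at hb
      have := hjump j' hj1 hj2 hb ha hadj.symm
      rw [show w (corner k j' true false) - w (corner k j' false false) =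
        -(w (corner k j' false false) - w (corner k j' true false)) by ring, this]
      simp
  have hpar := even_countP_iff_of_darts W (fun e => ∃ j', jb < j' ∧ j' ≤ jt ∧ e = rung k j') w hT
    hconst
  rw [hpar]
  -- (4) both ends are far from the loop: winding number zero
  have hu0 : w u = 0 := wind_sub_eq_zero_of_subset_ball σ hball hu
  have hv0 : w v = 0 := wind_sub_eq_zero_of_subset_ball σ hball hv
  rw [hu0, hv0, sub_zero]
  exact ⟨0, rfl⟩

end

end Literature.Probability.LatticeModels.Mesh
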